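import Summits.FinalStateConjecture.FinalStateConjecture.Theses.PhaseMixingCapture
import Literature.Geometry.Lorentzian.TameGenericityDiagonal
import Literature.Geometry.Lorentzian.TameGenericityLocal

/-!
# Line `SketchIdeator2` (card `only-the-third-law-is-generic`) — crux `CaptureSufficesTame`
# (stmt-FinalStateConjecture-17270, route PhaseMixingCapture, rank 6) — skeleton v3 (lead c2, 2026-08-17;
# v1 = kick form of the card's relative third law (a0, 00:19Z); v2 = the kick weakened to its ∃-form (a0/c1);
# v3 = the C⁰ → C² upgrade stub U FOLDED INTO THE KICK (this file): two stubs, A and R⁺)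

Crux (FIXED, concluded BY NAME in `CaptureSufficesTame_of`):
`PhaseMixingCapture.CaptureSufficesTame := NearExtremalKappaCapture → BulkKerrCaptureC2 →
WeakCosmicCensorshipTame → FinalStateConjecture`.

The card's factorisation (ideator 2): with censorship the crux's OWN third hypothesis, the re-typed summit follows
from POINTWISE statements shared with routes GlobalAttraction / TwoBoundarySqueeze plus ONE relative statement along
censored tame curves (tame genericities do not intersect — `CaptureSufficesTame.Negative.
not_isTameChristodoulouGeneric_and_closed`, p133982 — so `h₃` can only enter by composition along curves).

v2 (leads a0/c1) registered three stubs: A = item stmt-17296 verbatim (every censored MGHD carries an honest C⁰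
final-state decomposition), U = item stmt-17298 verbatim (an honest C⁰ configuration with sub-extremal LABELS upgrades
to the summit's honest C² decomposition) and the ∃-form kick R = `stub_unparkingKick` (small members censored and
UN-PARKED: whenever an MGHD carries some honest C⁰ configuration it carries one with sub-extremal labels). Both leads
flagged (`Cruxes/CaptureSufficesTame/LABEL-RIGIDITY-C0{,-c1}.md`) that at `k = 0` nothing in the tree pins the labels
`(Mᵢ, aᵢ)` of an honest decomposition to the spacetime: if C⁰ labels are floppy, "un-parked" is cheap and U is FALSE at
every censored extremal-settling development — the line would die at U for a reason foreign to its idea; if they are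
rigid (expected: equidimensional C⁰-approximate isometries of fat Kerr regions, c1 §3), U is the intended red-shift
upgrade. Deciding this is a research lemma in low-regularity Lorentzian rigidity, not available in tree or print.

v3 (this file) makes the line IMMUNE instead of waiting: U is folded into the kick. Registered stubs (2 ≤ stubs_max 7):
* `stub_censoredExteriorsSettleC0` — A, VERBATIM item stmt-FinalStateConjecture-17296 (pointwise, C⁰; unchanged from v2;
  wave 1: `stub-blocked: stmt-FinalStateConjecture-17296`).
* `stub_settlingKick` — R⁺ (HARDEST; the crux's own residue): SETTLING KICKS ALONG CENSORED CURVES — along every tame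
  admissible curve of censored data whose base datum is not (censored ∧ settled) there is a tame injective immersed
  admissible curve through the base whose small members are censored and SETTLED: every MGHD has complete `𝓘⁺` and,
  whenever it carries SOME honest C⁰ endpoint configuration, carries an honest C² final-state decomposition with
  sub-extremal holes. R⁺ never reads a C⁰ label, so LabelRigidityC0 does not touch it; R⁺ ⇐ R ∧ U pointwise and
  R⁺ ⟹ R (`settlingKick_of_unparkingKick_of_upgrade`, `unparkingKick_of_settlingKick`), R⁺ ⇐ items 17297 + 17298 + 9937
  (`settlingKick_of_globalAttraction`) — all LANDED p136198, `Theorems/PhaseMixingCaptureCaptureSufficesTameSettlingKickBridge.lean`;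
  and R⁺ is SUMMIT-IMPLIED (`settlingKick_of_finalStateConjecture`, LANDED p135956: the summit's own witness curve through
  the base datum is a settling kick), so it cannot be refuted short of refuting the summit. The line's only pointwise
  exposure is A.
Composition `CaptureSufficesTame_of` (§3, sorry-free): tame-generic censorship (the crux's `h₃`) ⟹ tame-generic
(censored ∧ settled) by the kick composition (`isTameChristodoulouGeneric_of_relativeKick`, LANDED p133270) ⟹ the
summit's matrix pointwise by stub A (`summitProperty_of_censored_settled`) ⟹ `FinalStateConjecture` ⟹ the crux
(`h₁`, `h₂` idle as typed). Theses-free reduction LANDED p135956 as `finalStateConjecture_of_settlingKick`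
(`Theorems/PhaseMixingCaptureCaptureSufficesTameSettlingKickReduction.lean`, with `finalStateConjecture_iff_settlingKick`:
modulo W and A the kick IS the summit).
-/

-- the doubled `FinalStateConjecture.FinalStateConjecture` path component trips dupNamespace
set_option linter.dupNamespace false

noncomputable section

open scoped Manifold ContDiff Topology ENNReal
open Set Function Filter

namespace Summit.FinalStateConjecture.FinalStateConjecture.Cruxes.CaptureSufficesTame.OnlyTheThirdLawIsGeneric

open Literature.Geometry.Lorentzian
open Summit.FinalStateConjecture (HasCompleteNullInfinity exteriorOf RaysStayInClosure HasExhaustiveCharts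
  IsFutureOriented)
open Summit.FinalStateConjecture.FinalStateConjecture.Theses.PhaseMixingCapture
  (NearExtremalKappaCapture BulkKerrCaptureC2 WeakCosmicCensorshipTame CaptureSufficesTame)

/-! ## §1 Vocabulary (short forms; the registered stubs of §2 are stated EXPANDED) -/

section Properties

variable {X : Type} [TopologicalSpace X] [ChartedSpace E3 X] [IsManifold (𝓡 3) ∞ X] [T2Space X]
  [SecondCountableTopology X] [ConnectedSpace X]

/-- CENSORED: the matrix of the crux's hypothesis `WeakCosmicCensorshipTame` — an MGHD exists and every
MGHD has complete future null infinity. -/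
def Censored (D : InitialDataSet (𝓡 3) X) : Prop :=
  (∃ 𝒟 : VacuumCauchyDevelopment D, 𝒟.IsMaximal) ∧
    ∀ 𝒟 : VacuumCauchyDevelopment D, 𝒟.IsMaximal → HasCompleteNullInfinity 𝒟.toCauchyDevelopment

/-- SETTLED (v3, the kick's target; = v2's UN-PARKED with the C⁰ → C² upgrade folded in): every MGHD has complete
`𝓘⁺` and, whenever it carries SOME honest C⁰ endpoint configuration (`O = exteriorOf`, rays in `closure O`,
exhaustive honest charts, future-oriented), carries an honest C² final-state decomposition with only SUB-extremal
holes — the summit's own matrix for that development. No C⁰ label is read. -/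
def SettledProperty (D : InitialDataSet (𝓡 3) X) : Prop :=
  ∀ 𝒟 : VacuumCauchyDevelopment D, 𝒟.IsMaximal →
    HasCompleteNullInfinity 𝒟.toCauchyDevelopment ∧
      ((∃ (O : Set 𝒟.carrier) (d₀ : FinalStateDecomposition 𝒟.toSpacetime O 0),
          O = exteriorOf 𝒟.toCauchyDevelopment d₀.charted ∧ RaysStayInClosure 𝒟.toCauchyDevelopment O ∧
            HasExhaustiveCharts d₀ ∧ IsFutureOriented d₀) →
        ∃ (O : Set 𝒟.carrier) (d : FinalStateDecomposition 𝒟.toSpacetime O 2),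
          (∀ i, Kerr.IsSubextremal (d.mass i) (d.spin i)) ∧
            O = exteriorOf 𝒟.toCauchyDevelopment d.charted ∧ RaysStayInClosure 𝒟.toCauchyDevelopment O ∧
              HasExhaustiveCharts d ∧ IsFutureOriented d)

/-- The summit's own matrix (verbatim the property inside `FinalStateConjecture`). -/
def SummitProperty (D : InitialDataSet (𝓡 3) X) : Prop :=
  (∃ 𝒟 : VacuumCauchyDevelopment D, 𝒟.IsMaximal) ∧
    ∀ 𝒟 : VacuumCauchyDevelopment D, 𝒟.IsMaximal →
      HasCompleteNullInfinity 𝒟.toCauchyDevelopment ∧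
        ∃ (O : Set 𝒟.carrier) (d : FinalStateDecomposition 𝒟.toSpacetime O 2),
          (∀ i, Kerr.IsSubextremal (d.mass i) (d.spin i)) ∧
            O = exteriorOf 𝒟.toCauchyDevelopment d.charted ∧ RaysStayInClosure 𝒟.toCauchyDevelopment O ∧
              HasExhaustiveCharts d ∧ IsFutureOriented d

omit [T2Space X] [SecondCountableTopology X] in
/-- The summit's matrix implies censored ∧ settled (so the kick's target is NECESSARY pointwise; the converse
needs stub A). [folklore] -/
theorem censored_and_settled_of_summitProperty {D : InitialDataSet (𝓡 3) X} (h : SummitProperty D) :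
    Censored D ∧ SettledProperty D :=
  ⟨⟨h.1, fun 𝒟 hmax ↦ (h.2 𝒟 hmax).1⟩, fun 𝒟 hmax ↦ ⟨(h.2 𝒟 hmax).1, fun _ ↦ (h.2 𝒟 hmax).2⟩⟩

end Properties

/-! ## §2 Registered stubs (the only `sorry`s of the file), stated EXPANDED over importable declarations
(`Statement.lean`, `TameGenericity.lean`) so that `--supports` files can state them verbatim. -/

/-- **Stub A `stub_censoredExteriorsSettleC0` — VERBATIM item stmt-FinalStateConjecture-17296**
(`GlobalAttraction.CensoredExteriorsSettle` = `TwoBoundarySqueeze.SqueezeToKerrFamilyC0`): every maximal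
vacuum Cauchy development with complete `𝓘⁺` of every admissible datum carries an HONEST C⁰ final-state
decomposition (extremal endpoints `|aᵢ| ≤ Mᵢ` allowed): `O = exteriorOf`, rays stay in `closure O`,
exhaustive charts with honest radii, future-oriented chart times. Pointwise, no genericity; crux rank 2 of
two served routes (grounded open-problem, g70-3). Pointwise exposure: smooth-category Kerr uniqueness (a censored
non-Kerr stationary vacuum black hole would be a counterexample). [cite: DafermosLuk2017, §1.2.1 p. 8] -/
theorem stub_censoredExteriorsSettleC0 :
    ∀ (X : Type) [TopologicalSpace X] [ChartedSpace E3 X] [IsManifold (𝓡 3) ∞ X] [T2Space X]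
      [SecondCountableTopology X] [ConnectedSpace X],
      ∀ D ∈ admissibleVacuumData X, ∀ 𝒟 : VacuumCauchyDevelopment D, 𝒟.IsMaximal →
        HasCompleteNullInfinity 𝒟.toCauchyDevelopment →
          ∃ (O : Set 𝒟.carrier) (d : FinalStateDecomposition 𝒟.toSpacetime O 0),
            O = exteriorOf 𝒟.toCauchyDevelopment d.charted ∧ RaysStayInClosure 𝒟.toCauchyDevelopment O ∧
              HasExhaustiveCharts d ∧ IsFutureOriented d := by
  sorry

/-- **Stub R⁺ `stub_settlingKick` (HARDEST; the crux's own residue; v3 = v2's `stub_unparkingKick` with the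
C⁰ → C² sub-extremal upgrade folded in) — SETTLING KICKS ALONG CENSORED CURVES, local form.** For every end `e`
and every tame admissible curve `F` on `e` whose members off `0` are CENSORED (`F` told immersed-injective, or
constant), and whose base datum `F 0` is NOT (censored ∧ settled), there are an end `e'`, a tame, injective,
immersed admissible curve `F'` through `F 0` and an `ε₀ > 0` such that every member with `0 < ‖c‖ < ε₀` is censored
AND settled: every MGHD of it has complete `𝓘⁺` and, whenever it carries some honest C⁰ endpoint configuration
(`O = exteriorOf`, rays in `closure O`, exhaustive honest charts, future-oriented), carries an honest C² final-state
decomposition with only SUB-extremal holes. Engine foreseen by the card: WALL (untrapped base: the black-hole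
threshold is crossed at first order) or FOLD (trapped base: the extremality defect is minimal at a parked member, so
the witness is the steep diagonal of a second-order unfolding) — the vacuum, asymmetric analogue of the
Angelopoulos–Kehle–Unger threshold theorem — followed by the red-shift upgrade at the (now sub-extremal) endpoints.
Open-problem-sized; SUMMIT-IMPLIED (`settlingKick_of_finalStateConjecture`); implied pointwise by v2's R ∧ U and by
GlobalAttraction's items 17297 + 17298 + 9937.
[cite: AngelopoulosKehleUnger2026, Thm 1] [cite: KehleUnger2025, Thm 1] [cite: DafermosRodnianski2013, §§3–7] -/
theorem stub_settlingKick :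
    ∀ (X : Type) [TopologicalSpace X] [ChartedSpace E3 X] [IsManifold (𝓡 3) ∞ X] [T2Space X]
      [SecondCountableTopology X] [ConnectedSpace X],
      ∀ (e : AFEnd X) (F : EuclideanSpace ℝ (Fin 1) → InitialDataSet (𝓡 3) X),
        InitialDataSet.IsTameDataFamily e 1 F →
          ((InitialDataSet.IsImmersedAtZero 1 F ∧ Function.Injective F) ∨ ∀ c, F c = F 0) →
          (∀ c, F c ∈ admissibleVacuumData X) →
          (∀ c ≠ 0, (∃ 𝒟 : VacuumCauchyDevelopment (F c), 𝒟.IsMaximal) ∧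
              ∀ 𝒟 : VacuumCauchyDevelopment (F c), 𝒟.IsMaximal →
                HasCompleteNullInfinity 𝒟.toCauchyDevelopment) →
          ¬ (((∃ 𝒟 : VacuumCauchyDevelopment (F 0), 𝒟.IsMaximal) ∧
                ∀ 𝒟 : VacuumCauchyDevelopment (F 0), 𝒟.IsMaximal →
                  HasCompleteNullInfinity 𝒟.toCauchyDevelopment) ∧
              ∀ 𝒟 : VacuumCauchyDevelopment (F 0), 𝒟.IsMaximal →
                HasCompleteNullInfinity 𝒟.toCauchyDevelopment ∧
                  ((∃ (O : Set 𝒟.carrier) (d₀ : FinalStateDecomposition 𝒟.toSpacetime O 0),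
                      O = exteriorOf 𝒟.toCauchyDevelopment d₀.charted ∧
                        RaysStayInClosure 𝒟.toCauchyDevelopment O ∧ HasExhaustiveCharts d₀ ∧
                          IsFutureOriented d₀) →
                    ∃ (O : Set 𝒟.carrier) (d : FinalStateDecomposition 𝒟.toSpacetime O 2),
                      (∀ i, Kerr.IsSubextremal (d.mass i) (d.spin i)) ∧
                        O = exteriorOf 𝒟.toCauchyDevelopment d.charted ∧
                          RaysStayInClosure 𝒟.toCauchyDevelopment O ∧ HasExhaustiveCharts d ∧
                            IsFutureOriented d)) →
          ∃ (e' : AFEnd X) (F' : EuclideanSpace ℝ (Fin 1) → InitialDataSet (𝓡 3) X),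
            InitialDataSet.IsTameDataFamily e' 1 F' ∧ F' 0 = F 0 ∧ Function.Injective F' ∧
              InitialDataSet.IsImmersedAtZero 1 F' ∧ (∀ c, F' c ∈ admissibleVacuumData X) ∧
              ∃ ε₀ > (0 : ℝ), ∀ c : EuclideanSpace ℝ (Fin 1), c ≠ 0 → ‖c‖ < ε₀ →
                ((∃ 𝒟 : VacuumCauchyDevelopment (F' c), 𝒟.IsMaximal) ∧
                    ∀ 𝒟 : VacuumCauchyDevelopment (F' c), 𝒟.IsMaximal →
                      HasCompleteNullInfinity 𝒟.toCauchyDevelopment) ∧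
                  ∀ 𝒟 : VacuumCauchyDevelopment (F' c), 𝒟.IsMaximal →
                    HasCompleteNullInfinity 𝒟.toCauchyDevelopment ∧
                      ((∃ (O : Set 𝒟.carrier) (d₀ : FinalStateDecomposition 𝒟.toSpacetime O 0),
                          O = exteriorOf 𝒟.toCauchyDevelopment d₀.charted ∧
                            RaysStayInClosure 𝒟.toCauchyDevelopment O ∧ HasExhaustiveCharts d₀ ∧
                              IsFutureOriented d₀) →
                        ∃ (O : Set 𝒟.carrier) (d : FinalStateDecomposition 𝒟.toSpacetime O 2),
                          (∀ i, Kerr.IsSubextremal (d.mass i) (d.spin i)) ∧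
                            O = exteriorOf 𝒟.toCauchyDevelopment d.charted ∧
                              RaysStayInClosure 𝒟.toCauchyDevelopment O ∧ HasExhaustiveCharts d ∧
                                IsFutureOriented d) := by
  sorry

/-! ## §3 The composition (sorry-free): the summit, hence the crux BY NAME -/

section Composition

variable {X : Type} [TopologicalSpace X] [ChartedSpace E3 X] [IsManifold (𝓡 3) ∞ X] [T2Space X]
  [SecondCountableTopology X] [ConnectedSpace X]

omit [T2Space X] [SecondCountableTopology X] [ConnectedSpace X] in
/-- **Composition of tame Christodoulou genericities along curves, KICK form.** As
`InitialDataSet.isTameChristodoulouGeneric_of_relative'`, but the relative witness is asked only along base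
curves whose base datum `F 0` FAILS the target property `P` (the composition never calls it elsewhere: its
base datum is an exceptional datum of `P`), and only LOCALLY in the parameter (good members for
`0 < ‖c‖ < ε`, made global by `InitialDataSet.isTameChristodoulouGeneric_of_local`). (Landed verbatim as
`Theorems.PhaseMixingCaptureCaptureSufficesTame.isTameChristodoulouGeneric_of_relativeKick`, p133270.) [folklore] -/
theorem isTameChristodoulouGeneric_of_relativeKick {𝓓 : Set (InitialDataSet (𝓡 3) X)}
    {Q P : InitialDataSet (𝓡 3) X → Prop}
    (h𝓓 : ∀ d ∈ 𝓓, ∃ e : AFEnd X, e.IsSoleEnd ∧ ∃ M : ℝ, e.IsStronglyAsymptoticallyFlatDR d M)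
    (hQ : InitialDataSet.IsTameChristodoulouGeneric 𝓓 Q 1)
    (hkick : ∀ (e : AFEnd X) (F : EuclideanSpace ℝ (Fin 1) → InitialDataSet (𝓡 3) X),
      InitialDataSet.IsTameDataFamily e 1 F →
        ((InitialDataSet.IsImmersedAtZero 1 F ∧ Injective F) ∨ ∀ c, F c = F 0) →
        (∀ c, F c ∈ 𝓓) → (∀ c ≠ 0, Q (F c)) → ¬ P (F 0) →
          ∃ (e' : AFEnd X) (F' : EuclideanSpace ℝ (Fin 1) → InitialDataSet (𝓡 3) X),
            InitialDataSet.IsTameDataFamily e' 1 F' ∧ F' 0 = F 0 ∧ Injective F' ∧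
              InitialDataSet.IsImmersedAtZero 1 F' ∧ (∀ c, F' c ∈ 𝓓) ∧
              ∃ ε > (0 : ℝ), ∀ c, c ≠ 0 → ‖c‖ < ε → P (F' c)) :
    InitialDataSet.IsTameChristodoulouGeneric 𝓓 P 1 := by
  refine InitialDataSet.isTameChristodoulouGeneric_of_local fun d hd𝓓 hdP ↦ ?_
  -- the tame base curve through `d`: constant if `Q d`, the `Q`-witness otherwise
  have base : ∃ (e : AFEnd X) (F : EuclideanSpace ℝ (Fin 1) → InitialDataSet (𝓡 3) X),
      InitialDataSet.IsTameDataFamily e 1 F ∧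
        ((InitialDataSet.IsImmersedAtZero 1 F ∧ Injective F) ∨ ∀ c, F c = F 0) ∧
        F 0 = d ∧ (∀ c, F c ∈ 𝓓) ∧ ∀ c ≠ 0, Q (F c) := by
    by_cases hQd : Q d
    · obtain ⟨e, hsole, M, hSAF⟩ := h𝓓 d hd𝓓
      exact ⟨e, fun _ ↦ d, InitialDataSet.isTameDataFamily_const hsole 1 hSAF, Or.inr fun _ ↦ rfl, rfl,
        fun _ ↦ hd𝓓, fun _ _ ↦ hQd⟩
    · obtain ⟨e, F, hF, himmF, h0, hinjF, h𝓓F, hE⟩ := hQ d ⟨hd𝓓, hQd⟩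
      refine ⟨e, F, hF, Or.inl ⟨himmF, hinjF⟩, h0, h𝓓F, fun c hc ↦ ?_⟩
      by_contra hQc
      exact hE c hc ⟨h𝓓F c, hQc⟩
  obtain ⟨e, F, hF, hFdich, hF0, hF𝓓, hFQ⟩ := base
  obtain ⟨e', F', hF', hF'0, hinj, himm, hF'𝓓, ε, hε, hP⟩ :=
    hkick e F hF hFdich hF𝓓 hFQ (by rwa [hF0])
  exact ⟨e', F', hF', himm, hF'0.trans hF0, hinj, hF'𝓓, ε, hε, hP⟩

/-- Pointwise key step (v3): a censored, SETTLED admissible datum satisfies the summit's matrix — stub A gives an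
honest C⁰ configuration of every MGHD, settled turns it into the summit's honest C² sub-extremal decomposition.
[folklore] -/
theorem summitProperty_of_censored_settled
    (hA : ∀ (X : Type) [TopologicalSpace X] [ChartedSpace E3 X] [IsManifold (𝓡 3) ∞ X] [T2Space X]
      [SecondCountableTopology X] [ConnectedSpace X],
      ∀ D ∈ admissibleVacuumData X, ∀ 𝒟 : VacuumCauchyDevelopment D, 𝒟.IsMaximal →
        HasCompleteNullInfinity 𝒟.toCauchyDevelopment →
          ∃ (O : Set 𝒟.carrier) (d : FinalStateDecomposition 𝒟.toSpacetime O 0),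
            O = exteriorOf 𝒟.toCauchyDevelopment d.charted ∧ RaysStayInClosure 𝒟.toCauchyDevelopment O ∧
              HasExhaustiveCharts d ∧ IsFutureOriented d)
    {D : InitialDataSet (𝓡 3) X} (hD : D ∈ admissibleVacuumData X) (hQ : Censored D)
    (hS : SettledProperty D) : SummitProperty D :=
  ⟨hQ.1, fun 𝒟 hmax ↦ ⟨hQ.2 𝒟 hmax, (hS 𝒟 hmax).2 (hA X D hD 𝒟 hmax (hQ.2 𝒟 hmax))⟩⟩

end Composition

/-- **The re-typed summit from the two registered stubs and the crux's third hypothesis.** `hW` is VERBATIM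
`WeakCosmicCensorshipTame`. Tame-generic censored (given) ⟹ tame-generic (censored ∧ settled)
(`isTameChristodoulouGeneric_of_relativeKick` with the kick stub R⁺) ⟹ tame-generic summit matrix (`mono` with
`summitProperty_of_censored_settled`, i.e. stub A pointwise). [folklore] -/
theorem finalStateConjecture_of_stubs (hW : WeakCosmicCensorshipTame) : _root_.FinalStateConjecture := by
  intro X _ _ _ _ _ _
  have h𝓓 : ∀ d ∈ admissibleVacuumData X,
      ∃ e : AFEnd X, e.IsSoleEnd ∧ ∃ M : ℝ, e.IsStronglyAsymptoticallyFlatDR d M :=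
    fun d hd ↦ exists_isSoleEnd_of_mem_admissibleVacuumData hd
  have gS : InitialDataSet.IsTameChristodoulouGeneric (admissibleVacuumData X)
      (fun D ↦ Censored D ∧ SettledProperty D) 1 :=
    isTameChristodoulouGeneric_of_relativeKick (Q := Censored) h𝓓 (hW X) (stub_settlingKick X)
  exact gS.mono fun D hD hDS ↦
    summitProperty_of_censored_settled stub_censoredExteriorsSettleC0 hD hDS.1 hDS.2

/-- **THE CRUX BY NAME (exactly the two registered stubs).** `CaptureSufficesTame` — its first two
hypotheses introduced and dropped (idle under the tame re-typing T2: tame witness members are globally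
small perturbations of the base datum, so the Cauchy-typed captures can be consumed neither at time zero
nor later; card F1, refuter crux-attack 2026-08-16), the third consumed as the source of censored base
curves. -/
theorem CaptureSufficesTame_of : CaptureSufficesTame :=
  fun _ _ hW ↦ finalStateConjecture_of_stubs hW

end Summit.FinalStateConjecture.FinalStateConjecture.Cruxes.CaptureSufficesTame.OnlyTheThirdLawIsGeneric

end
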